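import Literature.Barriers.ValiantsHypothesis.BIJL18TensorRankSlicesProofs
import Literature.Barriers.ValiantsHypothesis.BIJL18TPhiGapProofs
import Literature.Barriers.ValiantsHypothesis.BIJL18CompletionRankNPHardProofs
import Literature.LinearAlgebra.Matrix.RankMinors
import HarnessLib

/-!
# Bläser–Ikenmeyer–Jindal–Lysikov 2018, §5 — Theorem 18 applies to the tensor `T_φ`:
`R(T_φ) = CR(T_φ) + m`

Sibling proof file of `BIJL18MatrixCompletion.lean` (val-lit t23), step (4) of the discharge of
`BIJL2018_thm23` ("Tensor rank is NP-hard to approximate", ECCC TR18-064 p. 17: "By Theorem 18,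
`R(T_φ) = CR(T_φ) + k` where `k` is the total number of slices of `T_φ`"). Theorem 18
(`BIJL2018_thm18_holds`, sibling `BIJL18TensorRankSlicesProofs.lean`) needs two hypotheses on the
tensor `T_φ = (tphiA₀, tphiSlices)` of §5 which the print states without proof ("By construction, all
slices have rank 1 except for the 0th slice", p. 16) resp. leaves implicit (linear independence of
the slices); both are proved here for every 3-CNF `φ` with at least one clause in which every variable
`x ∈ Fin t` occurs:

* `TPhiRank.rank_tphiSlices_eq_one` — every slice `A_i`, `i ∈ SliceIdx φ`, has rank one (each is an
  explicit outer product with a nonzero entry: the variable slice of `x` at an occurrence of `x`, the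
  local slices at their `2 × 2` pattern / matrix unit, the auxiliary slices at their matrix unit);
* `TPhiRank.linearIndependent_tphi` — `A₀` and the `A_i` are linearly independent: a vanishing
  combination has coefficient `0` at `A₀` (otherwise the pencil `A₀ + Σ λ_i A_i` would vanish, but every
  pencil value has rank `≥ 5s ≥ 5`, `five_mul_length_le_completionRank_tphi`), and then the
  coefficients are read off at the positions (variable row, variable column) of an occurrence (variable
  slices), `(varCol, varCol)`, `(varCol, clauseRow)`, `(clauseRow, varCol)` of a slot (the three local
  slices) and (variable row of `h`, variable column of `l`) (the auxiliary slice of the pair `h ≠ l`);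
* `TPhiRank.tensorRank_tphi_reindex` — hence, for ANY numbering `e` of the rows/columns by `Fin n`
  and `g` of the slices by `Fin m`, `R = CR(T_φ) + m` for the reindexed tensor (Thm. 18 +
  `completionRank_reindex`); with Lemma 22 (1) (`completionRank_tphi_le_of_satisfiable`) and the
  repaired Lemma 22 (2) (`BIJL2018_lemma22_gap`, bounded occurrence): `TPhiRank.tensorRank_tphi_le_of_satisfiable`
  (`R ≤ 5s + m`) and `TPhiRank.le_tensorRank_tphi_of_gap` (`(5 + ε/c) s + m ≤ R`).

Theorem-only file (no definitions, no new fact). HONEST FRAMING: typed literature on an NP-hardness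
reduction; `VP ≠ VNP` is NOT proved and nothing here is progress on it.

## References

* [BlaserIkenmeyerJindalLysikov2018] M. Bläser, C. Ikenmeyer, G. Jindal, V. Lysikov, *Generalized
  matrix completion and algebraic natural proofs*, STOC 2018 / ECCC TR18-064, §5 (construction of
  `T_φ`, Lemma 21, Lemma 22, Thm. 23, pp. 13–17), Thm. 18 (p. 12).
-/

noncomputable section

namespace Literature.Barriers.ValiantsHypothesis

open Matrix Literature.Computability.Complexity Literature.Computability.AlgebraicComplexity

universe u

variable {K : Type u} [Field K] {t : ℕ}

namespace TPhiRank

open Lemma22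

/-! ### Small facts on the local row indices -/

/-- Variable rows (`2a`) and variable columns (`2a'+1`) of the gadget are distinct local indices. [cite: BlaserIkenmeyerJindalLysikov2018, §5 (the 9 × 9 clause gadget)] -/
theorem varRow_ne_varCol (a a' : Fin 3) : varRow a ≠ varCol a' := by
  intro h; have := congrArg Fin.val h; simp [varRow, varCol] at this; omega

/-- Variable rows and clause rows (`6+a'`) are distinct. [cite: BlaserIkenmeyerJindalLysikov2018, §5 (the 9 × 9 clause gadget)] -/
theorem varRow_ne_clauseRow (a a' : Fin 3) : varRow a ≠ clauseRow a' := by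
  intro h; have := congrArg Fin.val h; simp [varRow, clauseRow] at this; omega

/-- Variable columns and clause rows are distinct. [cite: BlaserIkenmeyerJindalLysikov2018, §5 (the 9 × 9 clause gadget)] -/
theorem varCol_ne_clauseRow (a a' : Fin 3) : varCol a ≠ clauseRow a' := by
  intro h; have := congrArg Fin.val h; simp [varCol, clauseRow] at this; omega

/-- `varRow` is injective. [cite: BlaserIkenmeyerJindalLysikov2018, §5 (the 9 × 9 clause gadget)] -/
theorem varRow_inj {a a' : Fin 3} : varRow a = varRow a' ↔ a = a' := by
  constructor
  · intro h; have := congrArg Fin.val h; simp [varRow] at this; exact Fin.ext (by omega)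
  · rintro rfl; rfl

/-- `varCol` is injective. [cite: BlaserIkenmeyerJindalLysikov2018, §5 (the 9 × 9 clause gadget)] -/
theorem varCol_inj {a a' : Fin 3} : varCol a = varCol a' ↔ a = a' := by
  constructor
  · intro h; have := congrArg Fin.val h; simp [varCol] at this; exact Fin.ext (by omega)
  · rintro rfl; rfl

/-- `clauseRow` is injective. [cite: BlaserIkenmeyerJindalLysikov2018, §5 (the 9 × 9 clause gadget)] -/
theorem clauseRow_inj {a a' : Fin 3} : clauseRow a = clauseRow a' ↔ a = a' := by
  constructor
  · intro h; have := congrArg Fin.val h; simp [clauseRow] at this; exact Fin.ext (by omega)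
  · rintro rfl; rfl

/-- The three slots. [folklore] -/
private theorem fin3_cases (wh : Fin 3) : wh = 0 ∨ wh = 1 ∨ wh = 2 := by
  fin_cases wh <;> decide

/-! ### Closed forms of the slices -/

variable (φ : List (Clause₃ t))

/-- The slice of the formula variable `x` (definitional form). [cite: BlaserIkenmeyerJindalLysikov2018, §5 (construction of `T_φ`, "a rank one matrix with 1's in all positions (i_h, j_ℓ)")] -/
theorem slice_inl_apply (x : Fin t) (p q : Fin φ.length × Fin 9) :
    tphiSlices K φ (Sum.inl x) p q =
      if (∃ a : Fin 3, ((φ.get p.1).lit a).1 = x ∧ p.2 = varRow a) ∧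
          (∃ a : Fin 3, ((φ.get q.1).lit a).1 = x ∧ q.2 = varCol a) then 1 else 0 := rfl

/-- The slice of the local variable `u`/`v`/`w` of slot `(j, a)`. [cite: BlaserIkenmeyerJindalLysikov2018, §5 (construction of `T_φ`)] -/
theorem slice_loc0_apply (j : Fin φ.length) (a : Fin 3) (p q : Fin φ.length × Fin 9) :
    tphiSlices K φ (Sum.inr (Sum.inl (j, a, 0))) p q =
      if p.1 = j ∧ q.1 = j then
        (if (p.2 = varCol a ∨ p.2 = clauseRow a) then
          (if q.2 = varCol a then 1 else if q.2 = clauseRow a then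
            (if ((φ.get j).lit a).2 then -1 else 1) else 0) else 0)
      else 0 := by
  simp only [tphiSlices]
  rfl

/-- The slice of the local variable `u₁`/`v₁`/`w₁` of slot `(j, a)` (matrix unit, value `-1`). [cite: BlaserIkenmeyerJindalLysikov2018, §5 (construction of `T_φ`)] -/
theorem slice_loc1_apply (j : Fin φ.length) (a : Fin 3) (p q : Fin φ.length × Fin 9) :
    tphiSlices K φ (Sum.inr (Sum.inl (j, a, 1))) p q =
      if p.1 = j ∧ q.1 = j then (if p.2 = varCol a ∧ q.2 = clauseRow a then -1 else 0) else 0 := by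
  have h10 : (1 : Fin 3) ≠ 0 := by decide
  simp only [tphiSlices, h10, if_false]
  rfl

/-- The slice of the local variable `u₂`/`v₂`/`w₂` of slot `(j, a)` (matrix unit, value `-1`). [cite: BlaserIkenmeyerJindalLysikov2018, §5 (construction of `T_φ`)] -/
theorem slice_loc2_apply (j : Fin φ.length) (a : Fin 3) (p q : Fin φ.length × Fin 9) :
    tphiSlices K φ (Sum.inr (Sum.inl (j, a, 2))) p q =
      if p.1 = j ∧ q.1 = j then (if p.2 = clauseRow a ∧ q.2 = varCol a then -1 else 0) else 0 := by
  have h20 : (2 : Fin 3) ≠ 0 := by decide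
  have h21 : (2 : Fin 3) ≠ 1 := by decide
  simp only [tphiSlices, h20, h21, if_false]

/-! ### Rank one -/

/-- A matrix with a nonzero entry has rank `≥ 1`. [cite: BlaserIkenmeyerJindalLysikov2018, Obs. 15] -/
theorem one_le_rank_of_apply_ne_zero {m n : Type*} [Fintype n] [DecidableEq n] (M : Matrix m n K) (i : m) (j : n)
    (h : M i j ≠ 0) : 1 ≤ M.rank := by
  have := Literature.LinearAlgebra.Matrix.card_le_rank_of_det_submatrix_ne_zero M
    (fun _ : Fin 1 => i) (fun _ => j) (by rw [Matrix.det_unique]; simpa using h)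
  simpa using this

/-- An outer product with a nonzero entry has rank exactly one. [cite: BlaserIkenmeyerJindalLysikov2018, Obs. 15] -/
theorem rank_eq_one_of_factor {m n : Type*} [Fintype n] [DecidableEq n] (M : Matrix m n K) (u : m → K) (v : n → K)
    (hM : ∀ p q, M p q = u p * v q) (i : m) (j : n) (h : M i j ≠ 0) : M.rank = 1 := by
  have hMv : M = vecMulVec u v := by ext p q; rw [hM, vecMulVec_apply]
  exact le_antisymm (hMv ▸ rank_vecMulVec_le u v) (one_le_rank_of_apply_ne_zero M i j h)

/-- Indicator of a conjunction as a product. [folklore] -/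
private theorem ite_and_eq_mul (A B : Prop) [Decidable A] [Decidable B] (y : K) :
    (if A ∧ B then y else 0) = (if A then 1 else 0) * (if B then y else 0) := by
  split_ifs <;> simp_all

/-- The slice of an OCCURRING formula variable has rank one. [cite: BlaserIkenmeyerJindalLysikov2018, §5 ("all slices have rank 1 except for the 0th slice")] -/
theorem rank_slice_inl (x : Fin t) (q₀ : Fin φ.length × Fin 3) (hq₀ : ((φ.get q₀.1).lit q₀.2).1 = x) :
    (tphiSlices K φ (Sum.inl x)).rank = 1 := by
  classical
  refine rank_eq_one_of_factor _
    (fun p => if ∃ a : Fin 3, ((φ.get p.1).lit a).1 = x ∧ p.2 = varRow a then 1 else 0)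
    (fun q => if ∃ a : Fin 3, ((φ.get q.1).lit a).1 = x ∧ q.2 = varCol a then 1 else 0)
    (fun p q => by rw [slice_inl_apply, ite_and_eq_mul]) (q₀.1, varRow q₀.2) (q₀.1, varCol q₀.2) ?_
  rw [slice_inl_apply, if_pos ⟨⟨q₀.2, hq₀, rfl⟩, ⟨q₀.2, hq₀, rfl⟩⟩]
  exact one_ne_zero

/-- The slice of `u`/`v`/`w` has rank one. [cite: BlaserIkenmeyerJindalLysikov2018, §5 ("all slices have rank 1")] -/
theorem rank_slice_loc0 (j : Fin φ.length) (a : Fin 3) :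
    (tphiSlices K φ (Sum.inr (Sum.inl (j, a, 0)))).rank = 1 := by
  classical
  refine rank_eq_one_of_factor _
    (fun p => if p.1 = j ∧ (p.2 = varCol a ∨ p.2 = clauseRow a) then 1 else 0)
    (fun q => if q.1 = j then (if q.2 = varCol a then 1 else if q.2 = clauseRow a then
            (if ((φ.get j).lit a).2 then -1 else 1) else 0) else 0)
    (fun p q => ?_) (j, varCol a) (j, varCol a) ?_
  · rw [slice_loc0_apply]
    by_cases h1 : p.1 = j <;> by_cases h2 : q.1 = j <;> by_cases h3 : (p.2 = varCol a ∨ p.2 = clauseRow a) <;>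
      simp [h1, h2, h3]
  · rw [slice_loc0_apply, if_pos ⟨rfl, rfl⟩, if_pos (Or.inl rfl), if_pos rfl]
    exact one_ne_zero

/-- The slice of `u₁`/`v₁`/`w₁` has rank one. [cite: BlaserIkenmeyerJindalLysikov2018, §5 ("all slices have rank 1")] -/
theorem rank_slice_loc1 (j : Fin φ.length) (a : Fin 3) :
    (tphiSlices K φ (Sum.inr (Sum.inl (j, a, 1)))).rank = 1 := by
  classical
  refine rank_eq_one_of_factor _
    (fun p => if p = (j, varCol a) then 1 else 0) (fun q => if q = (j, clauseRow a) then -1 else 0)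
    (fun p q => ?_) (j, varCol a) (j, clauseRow a) ?_
  · rw [slice_loc1_apply]
    obtain ⟨p1, p2⟩ := p
    obtain ⟨q1, q2⟩ := q
    simp only [Prod.mk.injEq]
    by_cases h1 : p1 = j <;> by_cases h2 : q1 = j <;> by_cases h3 : p2 = varCol a <;> by_cases h4 : q2 = clauseRow a <;>
      simp [h1, h2, h3, h4]
  · rw [slice_loc1_apply, if_pos ⟨rfl, rfl⟩, if_pos ⟨rfl, rfl⟩]
    exact neg_ne_zero.2 one_ne_zero

/-- The slice of `u₂`/`v₂`/`w₂` has rank one. [cite: BlaserIkenmeyerJindalLysikov2018, §5 ("all slices have rank 1")] -/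
theorem rank_slice_loc2 (j : Fin φ.length) (a : Fin 3) :
    (tphiSlices K φ (Sum.inr (Sum.inl (j, a, 2)))).rank = 1 := by
  classical
  refine rank_eq_one_of_factor _
    (fun p => if p = (j, clauseRow a) then 1 else 0) (fun q => if q = (j, varCol a) then -1 else 0)
    (fun p q => ?_) (j, clauseRow a) (j, varCol a) ?_
  · rw [slice_loc2_apply]
    obtain ⟨p1, p2⟩ := p
    obtain ⟨q1, q2⟩ := q
    simp only [Prod.mk.injEq]
    by_cases h1 : p1 = j <;> by_cases h2 : q1 = j <;> by_cases h3 : p2 = clauseRow a <;> by_cases h4 : q2 = varCol a <;>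
      simp [h1, h2, h3, h4]
  · rw [slice_loc2_apply, if_pos ⟨rfl, rfl⟩, if_pos ⟨rfl, rfl⟩]
    exact neg_ne_zero.2 one_ne_zero

/-- The auxiliary slices have rank one. [cite: BlaserIkenmeyerJindalLysikov2018, §5 ("an additional rank-one matrix with a 1 in this position")] -/
theorem rank_slice_aux (σ : Σ x : Fin t, {pp : Occ φ x × Occ φ x // pp.1 ≠ pp.2}) :
    (tphiSlices K φ (Sum.inr (Sum.inr σ))).rank = 1 := by
  classical
  refine rank_eq_one_of_factor _
    (fun p => if p = (σ.2.1.1.1.1, varRow σ.2.1.1.1.2) then 1 else 0)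
    (fun q => if q = (σ.2.1.2.1.1, varCol σ.2.1.2.1.2) then 1 else 0)
    (fun p q => by rw [tphiSlices_aux_apply, ite_and_eq_mul]) (σ.2.1.1.1.1, varRow σ.2.1.1.1.2)
    (σ.2.1.2.1.1, varCol σ.2.1.2.1.2) ?_
  rw [tphiSlices_aux_apply, if_pos ⟨rfl, rfl⟩]
  exact one_ne_zero

/-- **All slices of `T_φ` have rank one**, provided every variable occurs. [cite: BlaserIkenmeyerJindalLysikov2018, §5 ("By construction, all slices have rank 1 except for the 0th slice", p. 16)] -/
theorem rank_tphiSlices_eq_one (hocc : ∀ x : Fin t, ∃ q : Fin φ.length × Fin 3, ((φ.get q.1).lit q.2).1 = x)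
    (i : SliceIdx φ) : (tphiSlices K φ i).rank = 1 := by
  rcases i with x | ⟨j, a, wh⟩ | σ
  · obtain ⟨q₀, hq₀⟩ := hocc x
    exact rank_slice_inl φ x q₀ hq₀
  · fin_cases wh
    · exact rank_slice_loc0 φ j a
    · exact rank_slice_loc1 φ j a
    · exact rank_slice_loc2 φ j a
  · exact rank_slice_aux φ σ


/-! ### Linear independence of the slices -/

variable {φ}

/-- The variable slices vanish off the variable rows. [cite: BlaserIkenmeyerJindalLysikov2018, §5 (construction of `T_φ`)] -/
theorem slice_inl_eq_zero_of_fst (x : Fin t) {p q : Fin φ.length × Fin 9} (hp : ∀ a, p.2 ≠ varRow a) :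
    tphiSlices K φ (Sum.inl x) p q = 0 := by
  rw [slice_inl_apply, if_neg]
  rintro ⟨⟨a, -, ha⟩, -⟩
  exact hp a ha

/-- The local slices vanish on the variable rows. [cite: BlaserIkenmeyerJindalLysikov2018, §5 (construction of `T_φ`)] -/
theorem slice_loc_eq_zero_of_varRow (y : Fin φ.length × Fin 3 × Fin 3) {p q : Fin φ.length × Fin 9} (a : Fin 3)
    (hp : p.2 = varRow a) : tphiSlices K φ (Sum.inr (Sum.inl y)) p q = 0 := by
  obtain ⟨j₁, a₁, wh⟩ := y
  rcases fin3_cases wh with rfl | rfl | rfl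
  · rw [slice_loc0_apply]
    by_cases h1 : p.1 = j₁ ∧ q.1 = j₁
    · rw [if_pos h1, if_neg]
      rintro (h2 | h2)
      · exact varRow_ne_varCol a a₁ (hp.symm.trans h2)
      · exact varRow_ne_clauseRow a a₁ (hp.symm.trans h2)
    · rw [if_neg h1]
  · rw [slice_loc1_apply]
    by_cases h1 : p.1 = j₁ ∧ q.1 = j₁
    · rw [if_pos h1, if_neg]
      rintro ⟨h2, -⟩
      exact varRow_ne_varCol a a₁ (hp.symm.trans h2)
    · rw [if_neg h1]
  · rw [slice_loc2_apply]
    by_cases h1 : p.1 = j₁ ∧ q.1 = j₁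
    · rw [if_pos h1, if_neg]
      rintro ⟨h2, -⟩
      exact varRow_ne_clauseRow a a₁ (hp.symm.trans h2)
    · rw [if_neg h1]

/-- A local slice of another slot vanishes on the local/clause rows of slot `(j, a)`. [cite: BlaserIkenmeyerJindalLysikov2018, §5 (construction of `T_φ`)] -/
theorem slice_loc_eq_zero_of_ne {j j₁ : Fin φ.length} {a a₁ : Fin 3} (wh : Fin 3) {p q : Fin φ.length × Fin 9}
    (hp1 : p.1 = j) (hp2 : p.2 = varCol a ∨ p.2 = clauseRow a) (hne : (j₁, a₁) ≠ (j, a)) :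
    tphiSlices K φ (Sum.inr (Sum.inl (j₁, a₁, wh))) p q = 0 := by
  have key : p.1 = j₁ → a₁ ≠ a := by
    rintro h rfl; exact hne (Prod.ext (h.symm.trans hp1) rfl)
  rcases fin3_cases wh with rfl | rfl | rfl
  · rw [slice_loc0_apply]
    by_cases h1 : p.1 = j₁ ∧ q.1 = j₁
    · have ha := key h1.1
      rw [if_pos h1, if_neg]
      rcases hp2 with hp2 | hp2 <;> rintro (h2 | h2)
      · exact ha (varCol_inj.1 (h2.symm.trans hp2))
      · exact varCol_ne_clauseRow a a₁ (hp2.symm.trans h2)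
      · exact varCol_ne_clauseRow a₁ a (h2.symm.trans hp2)
      · exact ha (clauseRow_inj.1 (h2.symm.trans hp2))
    · rw [if_neg h1]
  · rw [slice_loc1_apply]
    by_cases h1 : p.1 = j₁ ∧ q.1 = j₁
    · have ha := key h1.1
      rw [if_pos h1, if_neg]
      rintro ⟨h2, -⟩
      rcases hp2 with hp2 | hp2
      · exact ha (varCol_inj.1 (h2.symm.trans hp2))
      · exact varCol_ne_clauseRow a₁ a (h2.symm.trans hp2)
    · rw [if_neg h1]
  · rw [slice_loc2_apply]
    by_cases h1 : p.1 = j₁ ∧ q.1 = j₁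
    · have ha := key h1.1
      rw [if_pos h1, if_neg]
      rintro ⟨h2, -⟩
      rcases hp2 with hp2 | hp2
      · exact varCol_ne_clauseRow a a₁ (hp2.symm.trans h2)
      · exact ha (clauseRow_inj.1 (h2.symm.trans hp2))
    · rw [if_neg h1]

/-- The auxiliary slice at a (variable row, variable column) position. [cite: BlaserIkenmeyerJindalLysikov2018, §5 (construction of `T_φ`)] -/
theorem slice_aux_apply' (σ : Σ x : Fin t, {pp : Occ φ x × Occ φ x // pp.1 ≠ pp.2})
    (j : Fin φ.length) (a : Fin 3) (j' : Fin φ.length) (a' : Fin 3) :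
    tphiSlices K φ (Sum.inr (Sum.inr σ)) (j, varRow a) (j', varCol a') =
      if σ.2.1.1.1 = (j, a) ∧ σ.2.1.2.1 = (j', a') then 1 else 0 := by
  rw [tphiSlices_aux_apply]
  congr 1
  simp only [Prod.mk.injEq, eq_iff_iff]
  constructor
  · rintro ⟨⟨h1, h2⟩, h3, h4⟩
    exact ⟨Prod.ext h1.symm (varRow_inj.1 h2).symm, Prod.ext h3.symm (varCol_inj.1 h4).symm⟩
  · rintro ⟨h1, h2⟩
    exact ⟨⟨(congrArg Prod.fst h1).symm, congrArg varRow (congrArg Prod.snd h1).symm⟩,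
      (congrArg Prod.fst h2).symm, congrArg varCol (congrArg Prod.snd h2).symm⟩

/-- The auxiliary slices vanish off the variable rows. [cite: BlaserIkenmeyerJindalLysikov2018, §5 (construction of `T_φ`)] -/
theorem slice_aux_eq_zero_of_fst (σ : Σ x : Fin t, {pp : Occ φ x × Occ φ x // pp.1 ≠ pp.2})
    {p q : Fin φ.length × Fin 9} (hp : ∀ a, p.2 ≠ varRow a) : tphiSlices K φ (Sum.inr (Sum.inr σ)) p q = 0 := by
  rw [tphiSlices_aux_apply, if_neg]
  rintro ⟨h1, -⟩
  exact hp _ (congrArg Prod.snd h1)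

/-- The variable part of a linear combination of slices at a (variable row, variable column) position. [cite: BlaserIkenmeyerJindalLysikov2018, §5 (construction of `T_φ`)] -/
theorem sum_inl_at (G : Fin t → K) (j : Fin φ.length) (a : Fin 3) (j' : Fin φ.length) (a' : Fin 3) :
    (∑ x, G x * tphiSlices K φ (Sum.inl x) (j, varRow a) (j', varCol a')) =
      if ((φ.get j').lit a').1 = ((φ.get j).lit a).1 then G ((φ.get j).lit a).1 else 0 := by
  rw [svar_apply]
  simp only
  rw [Finset.sum_eq_single a]
  · rw [Finset.sum_eq_single a']
    · simp
    · intro a₂ _ ha₂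
      rw [if_neg]
      rintro ⟨-, h2, -⟩
      exact ha₂ (varCol_inj.1 h2).symm
    · simp
  · intro a₁ _ ha₁
    refine Finset.sum_eq_zero fun a₂ _ => ?_
    rw [if_neg]
    rintro ⟨h1, -⟩
    exact ha₁ (varRow_inj.1 h1).symm
  · simp

/-- The local part of a linear combination at a position of slot `(j, a)`: only the three local slices of
the slot survive. [cite: BlaserIkenmeyerJindalLysikov2018, §5 (construction of `T_φ`)] -/
theorem sum_loc_eq (L : Fin φ.length × Fin 3 × Fin 3 → K) (j : Fin φ.length) (a : Fin 3) (p q : Fin φ.length × Fin 9)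
    (hp1 : p.1 = j) (hp2 : p.2 = varCol a ∨ p.2 = clauseRow a) :
    (∑ y, L y * tphiSlices K φ (Sum.inr (Sum.inl y)) p q) =
      ∑ wh : Fin 3, L (j, a, wh) * tphiSlices K φ (Sum.inr (Sum.inl (j, a, wh))) p q := by
  rw [Fintype.sum_prod_type, Finset.sum_eq_single j]
  · rw [Fintype.sum_prod_type, Finset.sum_eq_single a]
    · intro a₁ _ ha₁
      exact Finset.sum_eq_zero fun wh _ => by
        rw [slice_loc_eq_zero_of_ne wh hp1 hp2 (fun h => ha₁ (congrArg Prod.snd h)), mul_zero]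
    · simp
  · intro j₁ _ hj₁
    rw [Fintype.sum_prod_type]
    exact Finset.sum_eq_zero fun a₁ _ => Finset.sum_eq_zero fun wh _ => by
      rw [slice_loc_eq_zero_of_ne wh hp1 hp2 (fun h => hj₁ (congrArg Prod.fst h)), mul_zero]
  · simp

/-- The local part at `((j, varCol a), (j, varCol a))`. [cite: BlaserIkenmeyerJindalLysikov2018, §5 (construction of `T_φ`)] -/
theorem sum_loc_at_P0 (L : Fin φ.length × Fin 3 × Fin 3 → K) (j : Fin φ.length) (a : Fin 3) :
    (∑ y, L y * tphiSlices K φ (Sum.inr (Sum.inl y)) (j, varCol a) (j, varCol a)) = L (j, a, 0) := by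
  rw [sum_loc_eq L j a _ _ rfl (Or.inl rfl), Fin.sum_univ_three, slice_loc0_apply, slice_loc1_apply, slice_loc2_apply]
  have h1 := varCol_ne_clauseRow a a
  have h2 := Ne.symm h1
  simp only [true_and, true_or, if_true, and_true, h1, if_false, and_self]
  ring

/-- The local part at `((j, varCol a), (j, clauseRow a))`. [cite: BlaserIkenmeyerJindalLysikov2018, §5 (construction of `T_φ`)] -/
theorem sum_loc_at_P1 (L : Fin φ.length × Fin 3 × Fin 3 → K) (j : Fin φ.length) (a : Fin 3) :
    (∑ y, L y * tphiSlices K φ (Sum.inr (Sum.inl y)) (j, varCol a) (j, clauseRow a)) =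
      L (j, a, 0) * (if ((φ.get j).lit a).2 then -1 else 1) - L (j, a, 1) := by
  rw [sum_loc_eq L j a _ _ rfl (Or.inl rfl), Fin.sum_univ_three, slice_loc0_apply, slice_loc1_apply, slice_loc2_apply]
  have h1 := varCol_ne_clauseRow a a
  have h2 := Ne.symm h1
  simp only [true_or, if_true, h1, h2, if_false, and_self]
  ring

/-- The local part at `((j, clauseRow a), (j, varCol a))`. [cite: BlaserIkenmeyerJindalLysikov2018, §5 (construction of `T_φ`)] -/
theorem sum_loc_at_P2 (L : Fin φ.length × Fin 3 × Fin 3 → K) (j : Fin φ.length) (a : Fin 3) :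
    (∑ y, L y * tphiSlices K φ (Sum.inr (Sum.inl y)) (j, clauseRow a) (j, varCol a)) =
      L (j, a, 0) - L (j, a, 2) := by
  rw [sum_loc_eq L j a _ _ rfl (Or.inr rfl), Fin.sum_univ_three, slice_loc0_apply, slice_loc1_apply, slice_loc2_apply]
  have h1 := varCol_ne_clauseRow a a
  have h2 := Ne.symm h1
  simp only [or_true, if_true, h1, h2, if_false, and_self]
  ring

/-- The auxiliary part of a linear combination at a (variable row, variable column) position. [cite: BlaserIkenmeyerJindalLysikov2018, §5 (construction of `T_φ`)] -/
theorem sum_aux_at (M : (Σ x : Fin t, {pp : Occ φ x × Occ φ x // pp.1 ≠ pp.2}) → K)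
    (j : Fin φ.length) (a : Fin 3) (j' : Fin φ.length) (a' : Fin 3) :
    (∑ σ, M σ * tphiSlices K φ (Sum.inr (Sum.inr σ)) (j, varRow a) (j', varCol a')) =
      ∑ σ : (Σ x : Fin t, {pp : Occ φ x × Occ φ x // pp.1 ≠ pp.2}),
        if σ.2.1.1.1 = (j, a) ∧ σ.2.1.2.1 = (j', a') then M σ else 0 := by
  refine Finset.sum_congr rfl fun σ _ => ?_
  rw [slice_aux_apply', mul_ite, mul_one, mul_zero]

/-- At the own position of a slot no auxiliary slice contributes (`h ≠ l`). [cite: BlaserIkenmeyerJindalLysikov2018, §5 (construction of `T_φ`, pairs `h ≠ ℓ`)] -/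
theorem sum_aux_at_same (M : (Σ x : Fin t, {pp : Occ φ x × Occ φ x // pp.1 ≠ pp.2}) → K)
    (j : Fin φ.length) (a : Fin 3) :
    (∑ σ, M σ * tphiSlices K φ (Sum.inr (Sum.inr σ)) (j, varRow a) (j, varCol a)) = 0 := by
  rw [sum_aux_at]
  refine Finset.sum_eq_zero fun σ _ => if_neg ?_
  rintro ⟨h1, h2⟩
  exact σ.2.2 (Subtype.ext (h1.trans h2.symm))

/-- At the position of the pair `σ₀` exactly the auxiliary slice of `σ₀` contributes. [cite: BlaserIkenmeyerJindalLysikov2018, §5 (construction of `T_φ`)] -/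
theorem sum_aux_at_pair (M : (Σ x : Fin t, {pp : Occ φ x × Occ φ x // pp.1 ≠ pp.2}) → K)
    (σ₀ : Σ x : Fin t, {pp : Occ φ x × Occ φ x // pp.1 ≠ pp.2}) :
    (∑ σ, M σ * tphiSlices K φ (Sum.inr (Sum.inr σ)) (σ₀.2.1.1.1.1, varRow σ₀.2.1.1.1.2)
      (σ₀.2.1.2.1.1, varCol σ₀.2.1.2.1.2)) = M σ₀ := by
  classical
  rw [sum_aux_at, Finset.sum_eq_single σ₀]
  · simp
  · intro σ _ hσ
    rw [if_neg]
    rintro ⟨h1, h2⟩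
    apply hσ
    obtain ⟨x, ⟨⟨h, l⟩, hne⟩⟩ := σ
    obtain ⟨x₀, ⟨⟨h₀, l₀⟩, hne₀⟩⟩ := σ₀
    simp only at h1 h2
    have hx : x = x₀ := by rw [← h.2, ← h₀.2, h1]
    subst hx
    have hh : h = h₀ := Subtype.ext h1
    have hl : l = l₀ := Subtype.ext h2
    subst hh; subst hl
    rfl
  · simp

variable (φ) in
/-- **The slices `A₀, (A_i)_{i ∈ SliceIdx φ}` of `T_φ` are linearly independent** when `φ` has a
clause and every variable occurs (the hypothesis of Thm. 18 for `T_φ`, implicit in the printed proof of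
Thm. 23). [cite: BlaserIkenmeyerJindalLysikov2018, Thm. 23 (proof: "By Theorem 18, R(T_φ) = CR(T_φ) + k")] -/
theorem linearIndependent_tphi (hs : 0 < φ.length)
    (hocc : ∀ x : Fin t, ∃ q : Fin φ.length × Fin 3, ((φ.get q.1).lit q.2).1 = x) :
    LinearIndependent K (fun o : Option (SliceIdx φ) => (o.elim (tphiA₀ K φ) (tphiSlices K φ) :
      Matrix (Fin φ.length × Fin 9) (Fin φ.length × Fin 9) K)) := by
  classical
  rw [Fintype.linearIndependent_iff]
  intro g hg
  -- Step 0: the coefficient of `A₀` vanishes (every pencil value has rank `≥ 5s ≥ 5`)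
  have h0 : g none = 0 := by
    by_contra hne
    have hsum : (∑ o, g o • (o.elim (tphiA₀ K φ) (tphiSlices K φ) : Matrix _ _ K)) =
        g none • tphiA₀ K φ + ∑ k, g (some k) • tphiSlices K φ k := by
      rw [Fintype.sum_option]; rfl
    have hpencil : pencilEval (tphiA₀ K φ) (tphiSlices K φ) (fun k => (g none)⁻¹ * g (some k)) = 0 := by
      have : pencilEval (tphiA₀ K φ) (tphiSlices K φ) (fun k => (g none)⁻¹ * g (some k)) =
          (g none)⁻¹ • (g none • tphiA₀ K φ + ∑ k, g (some k) • tphiSlices K φ k) := by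
        rw [pencilEval, smul_add, smul_smul, inv_mul_cancel₀ hne, one_smul, Finset.smul_sum]
        simp_rw [smul_smul]
      rw [this, ← hsum, hg, smul_zero]
    have h5 := (five_mul_length_le_completionRank_tphi (K := K) φ).trans
      (completionRank_le (tphiA₀ K φ) (tphiSlices K φ) fun k => (g none)⁻¹ * g (some k))
    rw [hpencil, Matrix.rank_zero] at h5
    omega
  -- the combination evaluated at a position
  have heval : ∀ p q : Fin φ.length × Fin 9,
      (∑ x, g (some (Sum.inl x)) * tphiSlices K φ (Sum.inl x) p q) +
      ((∑ y, g (some (Sum.inr (Sum.inl y))) * tphiSlices K φ (Sum.inr (Sum.inl y)) p q) +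
       ∑ σ, g (some (Sum.inr (Sum.inr σ))) * tphiSlices K φ (Sum.inr (Sum.inr σ)) p q) = 0 := by
    intro p q
    have := congrFun (congrFun hg p) q
    rw [Matrix.sum_apply] at this
    simp only [Matrix.smul_apply, smul_eq_mul, Fintype.sum_option, Fintype.sum_sum_type, Option.elim_none,
      Option.elim_some, Matrix.zero_apply, h0, zero_mul, zero_add] at this
    exact this
  -- Step 1: formula variables
  have h1 : ∀ x, g (some (Sum.inl x)) = 0 := by
    intro x
    obtain ⟨⟨j, a⟩, hx⟩ := hocc x
    have := heval (j, varRow a) (j, varCol a)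
    rw [sum_inl_at, if_pos rfl, Finset.sum_eq_zero (fun y _ => by rw [slice_loc_eq_zero_of_varRow y a rfl, mul_zero]),
      sum_aux_at_same, add_zero, add_zero] at this
    simp only at hx
    rwa [hx] at this
  -- Step 2: local variables `u, v, w`
  have h2 : ∀ j a, g (some (Sum.inr (Sum.inl (j, a, 0)))) = 0 := by
    intro j a
    have := heval (j, varCol a) (j, varCol a)
    rwa [Finset.sum_eq_zero (fun x _ => by rw [slice_inl_eq_zero_of_fst x (fun a' => varRow_ne_varCol a' a |>.symm), mul_zero]),
      zero_add, sum_loc_at_P0,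
      Finset.sum_eq_zero (fun σ _ => by rw [slice_aux_eq_zero_of_fst σ (fun a' => varRow_ne_varCol a' a |>.symm), mul_zero]),
      add_zero] at this
  -- Step 3: local variables `u₁, …`
  have h3 : ∀ j a, g (some (Sum.inr (Sum.inl (j, a, 1)))) = 0 := by
    intro j a
    have := heval (j, varCol a) (j, clauseRow a)
    rw [Finset.sum_eq_zero (fun x _ => by rw [slice_inl_eq_zero_of_fst x (fun a' => varRow_ne_varCol a' a |>.symm), mul_zero]),
      zero_add, sum_loc_at_P1, h2,
      Finset.sum_eq_zero (fun σ _ => by rw [slice_aux_eq_zero_of_fst σ (fun a' => varRow_ne_varCol a' a |>.symm), mul_zero]),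
      add_zero] at this
    simpa using this
  -- Step 4: local variables `u₂, …`
  have h4 : ∀ j a, g (some (Sum.inr (Sum.inl (j, a, 2)))) = 0 := by
    intro j a
    have := heval (j, clauseRow a) (j, varCol a)
    rw [Finset.sum_eq_zero (fun x _ => by rw [slice_inl_eq_zero_of_fst x (fun a' => varRow_ne_clauseRow a' a |>.symm), mul_zero]),
      zero_add, sum_loc_at_P2, h2,
      Finset.sum_eq_zero (fun σ _ => by rw [slice_aux_eq_zero_of_fst σ (fun a' => varRow_ne_clauseRow a' a |>.symm), mul_zero]),
      add_zero] at this
    simpa using this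
  -- Step 5: auxiliary variables
  have h5 : ∀ σ, g (some (Sum.inr (Sum.inr σ))) = 0 := by
    intro σ
    have := heval (σ.2.1.1.1.1, varRow σ.2.1.1.1.2) (σ.2.1.2.1.1, varCol σ.2.1.2.1.2)
    rwa [sum_inl_at, Finset.sum_eq_zero (fun y _ => by rw [slice_loc_eq_zero_of_varRow y _ rfl, mul_zero]),
      sum_aux_at_pair, zero_add, h1, ite_self, zero_add] at this
  rintro (_ | x | ⟨j, a, wh⟩ | σ)
  · exact h0
  · exact h1 x
  · fin_cases wh
    · exact h2 j a
    · exact h3 j a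
    · exact h4 j a
  · exact h5 σ


/-! ### Theorem 18 for `T_φ` -/

variable (φ) in
/-- **`R = CR + m` for (any numbering of) `T_φ`**: Thm. 18 applies when `φ` has a clause and every
variable occurs. [cite: BlaserIkenmeyerJindalLysikov2018, Thm. 23 (proof: "By Theorem 18, R(T_φ) = CR(T_φ) + k where k is the total number of slices")] -/
theorem tensorRank_tphi_reindex (hs : 0 < φ.length)
    (hocc : ∀ x : Fin t, ∃ q : Fin φ.length × Fin 3, ((φ.get q.1).lit q.2).1 = x)
    {n m : ℕ} (e : Fin φ.length × Fin 9 ≃ Fin n) (g : Fin m ≃ SliceIdx φ) :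
    tensorRank (slicesTensor K ((tphiA₀ K φ).reindex e e) (fun k => (tphiSlices K φ (g k)).reindex e e)) =
      completionRank (tphiA₀ K φ) (tphiSlices K φ) + m := by
  have hA : ∀ k, ((tphiSlices K φ (g k)).reindex e e).rank = 1 := fun k => by
    rw [Matrix.rank_reindex]; exact rank_tphiSlices_eq_one φ hocc (g k)
  have hli : LinearIndependent K (fun o : Option (Fin m) =>
      (o.elim ((tphiA₀ K φ).reindex e e) (fun k => (tphiSlices K φ (g k)).reindex e e) :
        Matrix (Fin n) (Fin n) K)) := by
    have h := (linearIndependent_tphi φ hs hocc (K := K)).map'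
      (Matrix.reindexLinearEquiv K K e e : Matrix (Fin φ.length × Fin 9) (Fin φ.length × Fin 9) K →ₗ[K]
        Matrix (Fin n) (Fin n) K) (LinearEquiv.ker _)
    have h2 := (linearIndependent_equiv (Equiv.optionCongr g)).2 h
    have hfun : (fun o : Option (Fin m) =>
        (o.elim ((tphiA₀ K φ).reindex e e) (fun k => (tphiSlices K φ (g k)).reindex e e) : Matrix (Fin n) (Fin n) K)) =
        ((Matrix.reindexLinearEquiv K K e e : Matrix (Fin φ.length × Fin 9) (Fin φ.length × Fin 9) K →ₗ[K]
          Matrix (Fin n) (Fin n) K) ∘ fun o : Option (SliceIdx φ) =>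
            (o.elim (tphiA₀ K φ) (tphiSlices K φ) : Matrix (Fin φ.length × Fin 9) (Fin φ.length × Fin 9) K)) ∘
          (Equiv.optionCongr g) := by
      funext o
      cases o <;> rfl
    rw [hfun]
    exact h2
  rw [BIJL2018_thm18_holds K n m _ _ hli hA, completionRank_reindex]

variable (φ) in
/-- **Yes side**: for satisfiable `φ` (with a clause, every variable occurring), `R(T_φ) ≤ 5s + m`. [cite: BlaserIkenmeyerJindalLysikov2018, Lemma 22 (1) with Thm. 23 (proof)] -/
theorem tensorRank_tphi_le_of_satisfiable (hs : 0 < φ.length)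
    (hocc : ∀ x : Fin t, ∃ q : Fin φ.length × Fin 3, ((φ.get q.1).lit q.2).1 = x)
    {n m : ℕ} (e : Fin φ.length × Fin 9 ≃ Fin n) (g : Fin m ≃ SliceIdx φ)
    (hsat : ∃ σ : Fin t → Bool, numSat₃ φ σ = φ.length) :
    tensorRank (slicesTensor K ((tphiA₀ K φ).reindex e e) (fun k => (tphiSlices K φ (g k)).reindex e e)) ≤
      5 * φ.length + m := by
  rw [tensorRank_tphi_reindex φ hs hocc e g]
  exact Nat.add_le_add_right (completionRank_tphi_le_of_satisfiable K φ hsat) _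

variable (φ) in
/-- **No side**: if every variable occurs in at most `c ≥ 1` clauses and every assignment satisfies at
most `(1 − ε) s` clauses, then `(5 + ε/c) s + m ≤ R(T_φ)` (the repaired Lemma 22 (2), `BIJL2018_lemma22_gap`, with Thm. 18). [cite: BlaserIkenmeyerJindalLysikov2018, Lemma 22 (2) (repaired, erratum) with Thm. 23 (proof)] -/
theorem le_tensorRank_tphi_of_gap (hs : 0 < φ.length)
    (hocc : ∀ x : Fin t, ∃ q : Fin φ.length × Fin 3, ((φ.get q.1).lit q.2).1 = x)
    {n m : ℕ} (e : Fin φ.length × Fin 9 ≃ Fin n) (g : Fin m ≃ SliceIdx φ) (c : ℕ) (hc : 0 < c)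
    (hoccB : ∀ x : Fin t,
      (Finset.univ.filter fun j : Fin φ.length => ∃ a : Fin 3, ((φ.get j).lit a).1 = x).card ≤ c)
    (ε : ℚ) (hgap : ∀ σ : Fin t → Bool, (numSat₃ φ σ : ℚ) ≤ (1 - ε) * φ.length) :
    (5 + ε / c) * φ.length + m ≤
      (tensorRank (slicesTensor K ((tphiA₀ K φ).reindex e e) (fun k => (tphiSlices K φ (g k)).reindex e e)) : ℚ) := by
  rw [tensorRank_tphi_reindex φ hs hocc e g, Nat.cast_add]
  have := BIJL2018_lemma22_gap K φ c hc hoccB ε hgap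
  linarith

end TPhiRank

end Literature.Barriers.ValiantsHypothesis

end
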